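import Summits.Ventures.HodgeRepro2.T5SU11SturmComparison
import Summits.Ventures.HodgeRepro2.T5SU11LegendreSoninPolya

/-!
# The zeros of `P_n(cos θ)` by Sturm comparison: a zero in every interval `(kπ/(n+½), (k+1)π/(n+½))`, `1 ≤ k ≤ n − 1`

The Liouville transform `g(θ) = √(sin θ) · P_n(cos θ)` of row 459 satisfies, on `(0, π)`,

  **`g″ + ((n + ½)² + 1/(4 sin² θ)) g = 0`**  (`liouville_ode`; the square-root form of row 459's energy identity),

with `Φ(θ) = (n + ½)² + 1/(4 sin² θ) > (n + ½)²`. Sturm's comparison theorem (row 463) with `c = n + ½` therefore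
gives a zero of `g`, hence of `P_n(cos θ)`, in every interval `(α, α + π/(n + ½)) ⊂ (0, π)`:

  **for `1 ≤ k ≤ n − 1`, `P_n(cos θ)` has a zero in `(kπ/(n+½), (k+1)π/(n+½))`**  (`exists_zero_legP_cos`),

i.e. `P_n` has a zero in `(cos((k+1)π/(n+½)), cos(kπ/(n+½)))` (`exists_zero_legP`). Together with the count of
exactly `n` zeros in `(−1, 1)` (row 400) this localises the zeros `θ_1 < ⋯ < θ_n` of `P_n(cos θ)` to within one
period `π/(n + ½)` — the classical Sturm localisation (Szegő, Thm 6.21.2, in its weak form). Nothing is claimed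
about (N).

Blind lane: Mathlib + the HodgeRepro2 prefix only; no sorry; axioms ⊆ {propext, Classical.choice,
Quot.sound}.
-/

namespace Summit.Ventures.HodgeRepro2.T5SU11LegendreZerosSturm

open Set (Icc Ioo)
open scoped Real
open T5SU11SphericalLegendreAll T5SU11LegendreSoninPolya T5SU11SturmComparison

/-! ### The Liouville transform `g = √(sin θ) · P_n(cos θ)` -/

/-- `g(θ) = √(sin θ) · P_n(cos θ)`. -/
noncomputable def liou (n : ℕ) (θ : ℝ) : ℝ := Real.sqrt (Real.sin θ) * legTheta n θ

/-- `g′ = cos θ/(2√(sin θ)) · u + √(sin θ) · u′`. -/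
noncomputable def liou' (n : ℕ) (θ : ℝ) : ℝ :=
  Real.cos θ / (2 * Real.sqrt (Real.sin θ)) * legTheta n θ + Real.sqrt (Real.sin θ) * legTheta' n θ

/-- `g″`, as produced by the quotient and product rules. -/
noncomputable def liou'' (n : ℕ) (θ : ℝ) : ℝ :=
  (-Real.sin θ * (2 * Real.sqrt (Real.sin θ)) - Real.cos θ * (2 * (Real.cos θ / (2 * Real.sqrt (Real.sin θ)))))
      / (2 * Real.sqrt (Real.sin θ)) ^ 2 * legTheta n θ
    + Real.cos θ / (2 * Real.sqrt (Real.sin θ)) * legTheta' n θ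
    + (Real.cos θ / (2 * Real.sqrt (Real.sin θ)) * legTheta' n θ + Real.sqrt (Real.sin θ) * legTheta'' n θ)

/-- `sin θ > 0` on `(0, π)`. -/
theorem sin_pos_of_mem {θ : ℝ} (h0 : 0 < θ) (hπ : θ < π) : 0 < Real.sin θ := Real.sin_pos_of_pos_of_lt_pi h0 hπ

/-- `g′` is the derivative of `g` on `(0, π)`. -/
theorem hasDerivAt_liou (n : ℕ) {θ : ℝ} (h0 : 0 < θ) (hπ : θ < π) : HasDerivAt (liou n) (liou' n θ) θ := by
  have hs : Real.sin θ ≠ 0 := (sin_pos_of_mem h0 hπ).ne'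
  have h := ((Real.hasDerivAt_sin θ).sqrt hs).mul (hasDerivAt_legTheta n θ)
  show HasDerivAt (fun θ => Real.sqrt (Real.sin θ) * legTheta n θ) _ θ
  refine h.congr_deriv ?_
  unfold liou'
  ring

/-- `g″` is the derivative of `g′` on `(0, π)`. -/
theorem hasDerivAt_liou' (n : ℕ) {θ : ℝ} (h0 : 0 < θ) (hπ : θ < π) : HasDerivAt (liou' n) (liou'' n θ) θ := by
  have hs : Real.sin θ ≠ 0 := (sin_pos_of_mem h0 hπ).ne'
  have hr : 2 * Real.sqrt (Real.sin θ) ≠ 0 := by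
    have := Real.sqrt_pos.mpr (sin_pos_of_mem h0 hπ)
    positivity
  have hsq := (Real.hasDerivAt_sin θ).sqrt hs
  have h1 := ((Real.hasDerivAt_cos θ).div (hsq.const_mul 2) hr).mul (hasDerivAt_legTheta n θ)
  have h2 := hsq.mul (hasDerivAt_legTheta' n θ)
  have h := h1.add h2
  show HasDerivAt (fun θ => Real.cos θ / (2 * Real.sqrt (Real.sin θ)) * legTheta n θ
    + Real.sqrt (Real.sin θ) * legTheta' n θ) _ θ
  refine h.congr_deriv ?_
  unfold liou''
  simp only [Pi.div_apply]

/-- **The Liouville-transformed equation**: `g″ + ((n + ½)² + 1/(4 sin² θ)) g = 0` on `(0, π)`. -/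
theorem liouville_ode (n : ℕ) {θ : ℝ} (h0 : 0 < θ) (hπ : θ < π) :
    liou'' n θ + (((n : ℝ) + 1 / 2) ^ 2 + 1 / (4 * Real.sin θ ^ 2)) * liou n θ = 0 := by
  have hspos := sin_pos_of_mem h0 hπ
  have e := legTheta_ode n θ
  have hcs : Real.cos θ ^ 2 + Real.sin θ ^ 2 = 1 := Real.cos_sq_add_sin_sq θ
  unfold liou'' liou
  set r := Real.sqrt (Real.sin θ) with hr_def
  have hr2 : r ^ 2 = Real.sin θ := Real.sq_sqrt hspos.le
  have hr : r ≠ 0 := (Real.sqrt_pos.mpr hspos).ne'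
  rw [← hr2] at e hcs ⊢
  field_simp
  linear_combination (16 * r ^ 2) * e - 4 * legTheta n θ * hcs

/-! ### Sturm comparison for `P_n(cos θ)` -/

/-- **A zero of `P_n(cos θ)` in every interval `(α, α + π/(n+½)) ⊂ (0, π)`.** -/
theorem exists_zero_legP_cos_of_mem (n : ℕ) {α : ℝ} (h0 : 0 < α) (hπ : α + π / ((n : ℝ) + 1 / 2) < π) :
    ∃ θ ∈ Ioo α (α + π / ((n : ℝ) + 1 / 2)), legP n (Real.cos θ) = 0 := by
  have hc : 0 < (n : ℝ) + 1 / 2 := by positivity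
  have hmem : ∀ θ ∈ Icc α (α + π / ((n : ℝ) + 1 / 2)), 0 < θ ∧ θ < π :=
    fun θ hθ => ⟨lt_of_lt_of_le h0 hθ.1, lt_of_le_of_lt hθ.2 hπ⟩
  obtain ⟨θ, hθ, hg⟩ := exists_zero_of_sturm (g := liou n) (g' := liou' n) (g'' := liou'' n)
    (Φ := fun θ => ((n : ℝ) + 1 / 2) ^ 2 + 1 / (4 * Real.sin θ ^ 2)) hc rfl
    (fun θ hθ => hasDerivAt_liou n (hmem θ hθ).1 (hmem θ hθ).2)
    (fun θ hθ => hasDerivAt_liou' n (hmem θ hθ).1 (hmem θ hθ).2)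
    (fun θ hθ => liouville_ode n (hmem θ hθ).1 (hmem θ hθ).2)
    (fun θ hθ => by
      have hsθ := sin_pos_of_mem (hmem θ (Set.Ioo_subset_Icc_self hθ)).1 (hmem θ (Set.Ioo_subset_Icc_self hθ)).2
      have : 0 < 1 / (4 * Real.sin θ ^ 2) := by positivity
      show ((n : ℝ) + 1 / 2) ^ 2 < ((n : ℝ) + 1 / 2) ^ 2 + 1 / (4 * Real.sin θ ^ 2)
      linarith)
  refine ⟨θ, hθ, ?_⟩
  have hsθ := sin_pos_of_mem (hmem θ (Set.Ioo_subset_Icc_self hθ)).1 (hmem θ (Set.Ioo_subset_Icc_self hθ)).2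
  have hs : Real.sqrt (Real.sin θ) ≠ 0 := (Real.sqrt_pos.mpr hsθ).ne'
  unfold liou legTheta at hg
  exact (mul_eq_zero.mp hg).resolve_left hs

/-- **STURM'S LOCALISATION OF THE ZEROS**: for `1 ≤ k ≤ n − 1`, `P_n(cos θ)` has a zero in
`(kπ/(n+½), (k+1)π/(n+½))`. -/
theorem exists_zero_legP_cos (n : ℕ) {k : ℕ} (hk1 : 1 ≤ k) (hkn : k + 1 ≤ n) :
    ∃ θ ∈ Ioo ((k : ℝ) * π / ((n : ℝ) + 1 / 2)) (((k : ℝ) + 1) * π / ((n : ℝ) + 1 / 2)),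
      legP n (Real.cos θ) = 0 := by
  have hπ := Real.pi_pos
  have hc : 0 < (n : ℝ) + 1 / 2 := by positivity
  have hk1' : (1 : ℝ) ≤ k := by exact_mod_cast hk1
  have hkn' : (k : ℝ) + 1 ≤ n := by exact_mod_cast hkn
  have e : (k : ℝ) * π / ((n : ℝ) + 1 / 2) + π / ((n : ℝ) + 1 / 2) = ((k : ℝ) + 1) * π / ((n : ℝ) + 1 / 2) := by
    ring
  have h0 : 0 < (k : ℝ) * π / ((n : ℝ) + 1 / 2) := by positivity
  have hlt : (k : ℝ) * π / ((n : ℝ) + 1 / 2) + π / ((n : ℝ) + 1 / 2) < π := by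
    rw [e, div_lt_iff₀ hc]
    nlinarith
  obtain ⟨θ, hθ, h⟩ := exists_zero_legP_cos_of_mem n h0 hlt
  rw [e] at hθ
  exact ⟨θ, hθ, h⟩

/-- **In the variable `x`**: for `1 ≤ k ≤ n − 1`, `P_n` has a zero in `(cos((k+1)π/(n+½)), cos(kπ/(n+½)))`. -/
theorem exists_zero_legP (n : ℕ) {k : ℕ} (hk1 : 1 ≤ k) (hkn : k + 1 ≤ n) :
    ∃ x ∈ Ioo (Real.cos (((k : ℝ) + 1) * π / ((n : ℝ) + 1 / 2))) (Real.cos ((k : ℝ) * π / ((n : ℝ) + 1 / 2))),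
      legP n x = 0 := by
  have hπ := Real.pi_pos
  have hc : 0 < (n : ℝ) + 1 / 2 := by positivity
  have hkn' : (k : ℝ) + 1 ≤ n := by exact_mod_cast hkn
  obtain ⟨θ, hθ, h⟩ := exists_zero_legP_cos n hk1 hkn
  have h0 : 0 < (k : ℝ) * π / ((n : ℝ) + 1 / 2) := by positivity
  refine ⟨Real.cos θ, ⟨?_, ?_⟩, h⟩
  · apply Real.cos_lt_cos_of_nonneg_of_le_pi (lt_trans h0 hθ.1).le _ hθ.2
    rw [div_le_iff₀ hc]
    nlinarith
  · apply Real.cos_lt_cos_of_nonneg_of_le_pi (by positivity) _ hθ.1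
    have h2 := hθ.2
    have : ((k : ℝ) + 1) * π / ((n : ℝ) + 1 / 2) ≤ π := by
      rw [div_le_iff₀ hc]
      nlinarith
    linarith

end Summit.Ventures.HodgeRepro2.T5SU11LegendreZerosSturm
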